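import Mathlib
import HarnessLib
import Summits.Ventures.LatticeQCDFlow.Exactness.NCMCGeneralSpaceOccupancyChainCLT
import Summits.Ventures.LatticeQCDFlow.Exactness.NCMCGeneralSpaceOccupancyChainDoeblinWilson

/-!
# END TO END between two Wilson couplings: the NCMC lane with heat-bath link sweeps has Gaussian `√n`-fluctuations of the occupancy and of `dF_occ` from EVERY initial gauge field, for every `c ≠ ΔF`

HONEST FRAMING: exact (Metropolis-corrected) sampling algorithms for lattice gauge theory;
figures of merit are autocorrelation/cost numbers at stated couplings and volumes; no
continuum-physics claim.

Venture `LatticeQCDFlow` (cell pub-lqcd), topic `Exactness`; FANOUT row 13 (`eng-snf`, GEN-19).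
NEW WORK of the cell, not a published result; no definition is introduced; nothing is cited as a
fact.  ASSEMBLY of GEN-19's NCMC central limit theorems (`NCMCGeneralSpaceOccupancyChainCLT`:
`CrooksPair.ncmc_occupancy_clt_of_exists_sq`, `CrooksPair.ncmc_dFocc_clt_of_exists_sq`) with GEN-18's
unconditional two-step certificate for the coupling shape (`NCMCGeneralSpaceOccupancyChainDoeblinWilson`:
`wilson_heatBath_minorising`, `wilson_heatBathSweep_package`; `NCMCGeneralSpaceOccupancyChainDoeblinMirror`:
`CrooksPair.ncmc_exists_sq_doeblin`, `CrooksPair.bind_work_ne_ne_zero_of_ne` — the Jarzynski sign).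
Engine: `latflow-snf`, `correction = ncmc-metropolis`, prior `wilsonWeight ρ β₀`, target
`wilsonWeight ρ β₁` on the periodic lattice `(ℤ/L)^d` with compact structure group `G`, level samplers
the heat-bath link sweeps `updates.sweep(…, 'hb')` over edge lists visiting every edge, ANY Crooks
pair (any interleaving of exact sweeps and coupling layers certified as in GEN-9), ANY `c ≠ ΔF`.

## Content

* **`CrooksPair.ncmc_wilsonHeatBath_occupancy_clt_of_ne`** — for every initial state `z` of the
  expanded ensemble and every `Y ~ N(0, 2 τ_int(ρ_occ) σ(1 − σ))` (`σ = σ(c − ΔF)`,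
  `ρ_occ = setACF Q π_c (target level)`): `√n (p̂_n − σ) ⇒ Y` under `P_{δ_z}`.
* **`CrooksPair.ncmc_wilsonHeatBath_dFocc_clt_of_ne`** — for every `Y ~ N(0, 2 τ_int(ρ_occ)/(σ(1 − σ)))`:
  `√n (dF_occ,n − ΔF) ⇒ Y` under `P_{δ_z}`.

Reading for the engine (value-free): between two Wilson couplings the reported `dF_occ` of
`run_ncmc_chain` with heat-bath sweeps is asymptotically normal at rate `n^{−1/2}` with variance
`2 τ_int(ρ_occ)/(σ(1 − σ))` from every cold or hot start and every `c ≠ ΔF`; the interval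
`dF_occ ± z √(2 τ̄ /(n p̂(1 − p̂)))` with any `τ̄ ≥ τ_int(ρ_occ)` (GEN-18's certified bound
`1/2 + (2/ε − 1)/(1 − σ)`, or a measured one) has asymptotic coverage `≥ N(0,1)([−z, z])`.
NOT CLAIMED: the value of `τ_int(ρ_occ)` or of `ε` (measured figures of merit); a typed consistent
estimator of `τ_int`; rates; `c = ΔF` with `W ≡ ΔF`.
-/

namespace Summit.Ventures.LatticeQCDFlow.Exactness.GeneralNCMC

open MeasureTheory ProbabilityTheory Set Filter Finset
open scoped ENNReal Topology

section Wilson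

open Literature.MathematicalPhysics.QuantumFieldTheory

variable {d L N : ℕ} {G : Type*} [Group G] [TopologicalSpace G] [IsTopologicalGroup G]
  (ρ : G →* Matrix (Fin N) (Fin N) ℂ) [CompactSpace G] [MeasurableSpace G] [BorelSpace G]
  [SecondCountableTopology G]

/-- **THE OCCUPANCY CLT BETWEEN TWO WILSON COUPLINGS, FROM EVERY INITIAL GAUGE FIELD, EVERY `c ≠ ΔF`.**
Prior `wilsonWeight ρ β₀`, target `wilsonWeight ρ β₁`, heat-bath link sweeps over edge lists visiting
every edge, ANY Crooks pair, `c ≠ ΔF`: for every initial state `z` and every real random variable `Y`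
with law `N(0, 2 τ_int(ρ_occ) σ(1 − σ))`, `√n (p̂_n − σ(c − ΔF))` converges in distribution to `Y`
under the chain law `P_{δ_z}` of `run_ncmc_chain`. -/
theorem CrooksPair.ncmc_wilsonHeatBath_occupancy_clt_of_ne [NeZero L] (hρ : Continuous ρ)
    (β₀ β₁ : ℝ) {l₀ l₁ : List (Edge d L)} (hl₀ : ∀ ed, ed ∈ l₀) (hl₁ : ∀ ed, ed ∈ l₁)
    {E : Type*} [MeasurableSpace E] {κF κR : Kernel (GaugeConfig d L G) E} [IsMarkovKernel κF]
    [IsMarkovKernel κR] {s e : E → GaugeConfig d L G} {W : E → ℝ}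
    (h : CrooksPair (wilsonWeight (d := d) (L := L) ρ β₀) (wilsonWeight (d := d) (L := L) ρ β₁)
      κF κR s e W) {c ΔF : ℝ}
    (hΔF : Real.exp (-ΔF) = (((wilsonWeight (d := d) (L := L) ρ β₀) univ)⁻¹ *
      (wilsonWeight (d := d) (L := L) ρ β₁) univ).toReal) (hc : c ≠ ΔF) :
    ∃ (_ : IsMarkovKernel (switchKernel κF κR c W s e))
      (_ : IsMarkovKernel (levelKernel
        (cycle (l₀.map (siteHeatBath (fun _ : Edge d L => haarProbability G)
          (gibbsDensity fun U : GaugeConfig d L G => β₀ * wilsonAction ρ U))))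
        (cycle (l₁.map (siteHeatBath (fun _ : Edge d L => haarProbability G)
          (gibbsDensity fun U : GaugeConfig d L G => β₁ * wilsonAction ρ U)))))),
      ∀ (z : Bool × GaugeConfig d L G)
        [IsProbabilityMeasure (Kernel.trajMeasure (X := fun _ : ℕ => Bool × GaugeConfig d L G)
          (Measure.dirac z)
          (fun n : ℕ => (switchKernel κF κR c W s e ∘ₖ levelKernel
            (cycle (l₀.map (siteHeatBath (fun _ : Edge d L => haarProbability G)
              (gibbsDensity fun U : GaugeConfig d L G => β₀ * wilsonAction ρ U))))
            (cycle (l₁.map (siteHeatBath (fun _ : Edge d L => haarProbability G)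
              (gibbsDensity fun U : GaugeConfig d L G => β₁ * wilsonAction ρ U))))).comap
            (fun hh : (j : ↥(Finset.Iic n)) → Bool × GaugeConfig d L G =>
              hh ⟨n, Finset.mem_Iic.2 le_rfl⟩) (measurable_pi_apply _)))]
        {Ω' : Type*} [MeasurableSpace Ω'] {P' : Measure Ω'} [IsProbabilityMeasure P'] {Y : Ω' → ℝ},
        HasLaw Y (gaussianReal 0 (Real.toNNReal
          (2 * Scoring.tauInt (setACF (switchKernel κF κR c W s e ∘ₖ levelKernel
              (cycle (l₀.map (siteHeatBath (fun _ : Edge d L => haarProbability G)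
                (gibbsDensity fun U : GaugeConfig d L G => β₀ * wilsonAction ρ U))))
              (cycle (l₁.map (siteHeatBath (fun _ : Edge d L => haarProbability G)
                (gibbsDensity fun U : GaugeConfig d L G => β₁ * wilsonAction ρ U)))))
            ((jointWeight c (wilsonWeight (d := d) (L := L) ρ β₀)
                (wilsonWeight (d := d) (L := L) ρ β₁) univ)⁻¹ •
              jointWeight c (wilsonWeight (d := d) (L := L) ρ β₀) (wilsonWeight (d := d) (L := L) ρ β₁))
            (targetLevel (GaugeConfig d L G)))
            * (Real.sigmoid (c - ΔF) * (1 - Real.sigmoid (c - ΔF)))))) P' →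
        TendstoInDistribution (fun (n : ℕ) (x : ℕ → Bool × GaugeConfig d L G) =>
            Real.sqrt n * ((∑ i ∈ range n, (targetLevel (GaugeConfig d L G)).indicator
              (1 : Bool × GaugeConfig d L G → ℝ) (x i)) / n - Real.sigmoid (c - ΔF)))
          atTop Y (fun _ => Kernel.trajMeasure (X := fun _ : ℕ => Bool × GaugeConfig d L G)
            (Measure.dirac z)
            (fun n : ℕ => (switchKernel κF κR c W s e ∘ₖ levelKernel
              (cycle (l₀.map (siteHeatBath (fun _ : Edge d L => haarProbability G)
                (gibbsDensity fun U : GaugeConfig d L G => β₀ * wilsonAction ρ U))))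
              (cycle (l₁.map (siteHeatBath (fun _ : Edge d L => haarProbability G)
                (gibbsDensity fun U : GaugeConfig d L G => β₁ * wilsonAction ρ U))))).comap
              (fun hh : (j : ↥(Finset.Iic n)) → Bool × GaugeConfig d L G =>
                hh ⟨n, Finset.mem_Iic.2 le_rfl⟩) (measurable_pi_apply _))) P' := by
  obtain ⟨hMk₀, hfin₀, -, -, h0, -, hK₀, -⟩ := wilson_heatBathSweep_package ρ hρ β₀ hl₀
  obtain ⟨hMk₁, hfin₁, -, -, h1, -, hK₁, -⟩ := wilson_heatBathSweep_package ρ hρ β₁ hl₁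
  obtain ⟨m₀, hmfin₀, hm₀, hmin₀, hac₀⟩ := wilson_heatBath_minorising ρ hρ β₀ hl₀
  obtain ⟨m₁, hmfin₁, hm₁, hmin₁, hac₁⟩ := wilson_heatBath_minorising ρ hρ β₁ hl₁
  haveI := hMk₀
  haveI := hMk₁
  haveI := hfin₀
  haveI := hfin₁
  haveI := hmfin₀
  haveI := hmfin₁
  refine ⟨isMarkovKernel_switchKernel (κF := κF) (κR := κR) (c := c)
      h.measurable_W h.measurable_s h.measurable_e, isMarkovKernel_levelKernel _ _,
    fun z _ Ω' _ P' _ Y hY => ?_⟩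
  exact h.ncmc_occupancy_clt_of_exists_sq h0 h1 hK₀ hK₁
    (h.ncmc_exists_sq_doeblin hm₀ hm₁ hmin₀ hmin₁ hac₀ hac₁ c
      (h.bind_work_ne_ne_zero_of_ne h0 hΔF hc)) hΔF z hY

/-- **THE `dF_occ` CLT BETWEEN TWO WILSON COUPLINGS, FROM EVERY INITIAL GAUGE FIELD, EVERY `c ≠ ΔF`**:
for every initial state `z` and every `Y` with law `N(0, 2 τ_int(ρ_occ)/(σ(1 − σ)))`,
`√n (dF_occ,n − ΔF)` converges in distribution to `Y` under `P_{δ_z}`. -/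
theorem CrooksPair.ncmc_wilsonHeatBath_dFocc_clt_of_ne [NeZero L] (hρ : Continuous ρ)
    (β₀ β₁ : ℝ) {l₀ l₁ : List (Edge d L)} (hl₀ : ∀ ed, ed ∈ l₀) (hl₁ : ∀ ed, ed ∈ l₁)
    {E : Type*} [MeasurableSpace E] {κF κR : Kernel (GaugeConfig d L G) E} [IsMarkovKernel κF]
    [IsMarkovKernel κR] {s e : E → GaugeConfig d L G} {W : E → ℝ}
    (h : CrooksPair (wilsonWeight (d := d) (L := L) ρ β₀) (wilsonWeight (d := d) (L := L) ρ β₁)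
      κF κR s e W) {c ΔF : ℝ}
    (hΔF : Real.exp (-ΔF) = (((wilsonWeight (d := d) (L := L) ρ β₀) univ)⁻¹ *
      (wilsonWeight (d := d) (L := L) ρ β₁) univ).toReal) (hc : c ≠ ΔF) :
    ∃ (_ : IsMarkovKernel (switchKernel κF κR c W s e))
      (_ : IsMarkovKernel (levelKernel
        (cycle (l₀.map (siteHeatBath (fun _ : Edge d L => haarProbability G)
          (gibbsDensity fun U : GaugeConfig d L G => β₀ * wilsonAction ρ U))))
        (cycle (l₁.map (siteHeatBath (fun _ : Edge d L => haarProbability G)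
          (gibbsDensity fun U : GaugeConfig d L G => β₁ * wilsonAction ρ U)))))),
      ∀ (z : Bool × GaugeConfig d L G)
        [IsProbabilityMeasure (Kernel.trajMeasure (X := fun _ : ℕ => Bool × GaugeConfig d L G)
          (Measure.dirac z)
          (fun n : ℕ => (switchKernel κF κR c W s e ∘ₖ levelKernel
            (cycle (l₀.map (siteHeatBath (fun _ : Edge d L => haarProbability G)
              (gibbsDensity fun U : GaugeConfig d L G => β₀ * wilsonAction ρ U))))
            (cycle (l₁.map (siteHeatBath (fun _ : Edge d L => haarProbability G)
              (gibbsDensity fun U : GaugeConfig d L G => β₁ * wilsonAction ρ U))))).comap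
            (fun hh : (j : ↥(Finset.Iic n)) → Bool × GaugeConfig d L G =>
              hh ⟨n, Finset.mem_Iic.2 le_rfl⟩) (measurable_pi_apply _)))]
        {Ω' : Type*} [MeasurableSpace Ω'] {P' : Measure Ω'} [IsProbabilityMeasure P'] {Y : Ω' → ℝ},
        HasLaw Y (gaussianReal 0 (Real.toNNReal
          (2 * Scoring.tauInt (setACF (switchKernel κF κR c W s e ∘ₖ levelKernel
              (cycle (l₀.map (siteHeatBath (fun _ : Edge d L => haarProbability G)
                (gibbsDensity fun U : GaugeConfig d L G => β₀ * wilsonAction ρ U))))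
              (cycle (l₁.map (siteHeatBath (fun _ : Edge d L => haarProbability G)
                (gibbsDensity fun U : GaugeConfig d L G => β₁ * wilsonAction ρ U)))))
            ((jointWeight c (wilsonWeight (d := d) (L := L) ρ β₀)
                (wilsonWeight (d := d) (L := L) ρ β₁) univ)⁻¹ •
              jointWeight c (wilsonWeight (d := d) (L := L) ρ β₀) (wilsonWeight (d := d) (L := L) ρ β₁))
            (targetLevel (GaugeConfig d L G)))
            / (Real.sigmoid (c - ΔF) * (1 - Real.sigmoid (c - ΔF)))))) P' →
        TendstoInDistribution (fun (n : ℕ) (x : ℕ → Bool × GaugeConfig d L G) =>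
            Real.sqrt n * ((c - Real.log
              ((∑ i ∈ range n, (targetLevel (GaugeConfig d L G)).indicator
                  (1 : Bool × GaugeConfig d L G → ℝ) (x i)) / n /
                (1 - (∑ i ∈ range n, (targetLevel (GaugeConfig d L G)).indicator
                  (1 : Bool × GaugeConfig d L G → ℝ) (x i)) / n))) - ΔF))
          atTop Y (fun _ => Kernel.trajMeasure (X := fun _ : ℕ => Bool × GaugeConfig d L G)
            (Measure.dirac z)
            (fun n : ℕ => (switchKernel κF κR c W s e ∘ₖ levelKernel
              (cycle (l₀.map (siteHeatBath (fun _ : Edge d L => haarProbability G)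
                (gibbsDensity fun U : GaugeConfig d L G => β₀ * wilsonAction ρ U))))
              (cycle (l₁.map (siteHeatBath (fun _ : Edge d L => haarProbability G)
                (gibbsDensity fun U : GaugeConfig d L G => β₁ * wilsonAction ρ U))))).comap
              (fun hh : (j : ↥(Finset.Iic n)) → Bool × GaugeConfig d L G =>
                hh ⟨n, Finset.mem_Iic.2 le_rfl⟩) (measurable_pi_apply _))) P' := by
  obtain ⟨hMk₀, hfin₀, -, -, h0, -, hK₀, -⟩ := wilson_heatBathSweep_package ρ hρ β₀ hl₀
  obtain ⟨hMk₁, hfin₁, -, -, h1, -, hK₁, -⟩ := wilson_heatBathSweep_package ρ hρ β₁ hl₁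
  obtain ⟨m₀, hmfin₀, hm₀, hmin₀, hac₀⟩ := wilson_heatBath_minorising ρ hρ β₀ hl₀
  obtain ⟨m₁, hmfin₁, hm₁, hmin₁, hac₁⟩ := wilson_heatBath_minorising ρ hρ β₁ hl₁
  haveI := hMk₀
  haveI := hMk₁
  haveI := hfin₀
  haveI := hfin₁
  haveI := hmfin₀
  haveI := hmfin₁
  refine ⟨isMarkovKernel_switchKernel (κF := κF) (κR := κR) (c := c)
      h.measurable_W h.measurable_s h.measurable_e, isMarkovKernel_levelKernel _ _,
    fun z _ Ω' _ P' _ Y hY => ?_⟩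
  exact h.ncmc_dFocc_clt_of_exists_sq h0 h1 hK₀ hK₁
    (h.ncmc_exists_sq_doeblin hm₀ hm₁ hmin₀ hmin₁ hac₀ hac₁ c
      (h.bind_work_ne_ne_zero_of_ne h0 hΔF hc)) hΔF z hY

end Wilson

end Summit.Ventures.LatticeQCDFlow.Exactness.GeneralNCMC
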